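import Summits.BirchSwinnertonDyer.BirchSwinnertonDyer.Theorems.ByReductionTypeAtTwoMultTowerClass100342a
import Summits.BirchSwinnertonDyer.BirchSwinnertonDyer.Theorems.ByReductionTypeAtTwoMultKatoRatOfInputsTwo
import Literature.NumberTheory.EllipticCurves.Greenberg1999.ControlLocalKernelsLayerMultiplicativeProofs
import HarnessLib

/-!
# WORKED RE-KEY of a MULTIPLICATIVE TOWER class row on the K11 kernel road: `BSD(100342a1, 2)` with the
# MEMO binder `hKato` REPLACED by Kato's located inputs (and `hM` by tower-1's theorem)

Cell `bsd-2adic` (run/shared/lean/pub/bsd-2adic/), seat `bsd-2adic-mult` GEN 9; HUMAN RULINGS D-0036 /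
D-0054. HONEST FRAMING: research route; nothing is asserted; no class is closed here; no count moves;
this is the TEMPLATE showing the planner / referee the exact displayed-binder list of a mult tower row
once `hKato` (K11 = `O1.KatoMultiplicativeDivisibilityRat W 2`, hitherto MEMO: PROOF-MULT RC-2) goes
through `MultKatoRat.katoMultiplicativeDivisibilityRat_forall_two_of_inputs`. PARTITION: X5@2 mult
NON-SPLIT, E[2]-irreducible (K4ᵐ, B1·O1), class 100342a × p = 2 — types-the-object-of; closes none.

Binders of `bsdp_two_100342a1_l03_of_katoInputs` (compare mult-2's `MultTowerClass.bsdp_two_100342a1_l03`):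
* KATO INPUTS: `hne` (12.2.1)/p. 228 and `h12` Thm. 12.4 (2) (accepted Literature facts, any prime);
  `hns` / `hsp` = the Summits-side `p = 2` packages `MultKatoInputs.exists_multDivisibilityInputs_{nonsplit,split}_two`
  (`ByReductionTypeAtTwoMultKatoInputsDefs.lean`; the `p := 2` siblings of the odd-prime Literature
  facts; ONE unprinted field each: Coleman-map injectivity, Prop. 17.11 at non-split / Kobayashi 4.1 at
  split — the located residue of K11, MEMO-grade);
* PRINT: `h15` (Greenberg Thm. 1.5), `h41ns'`, `h41sp` (Greenberg Thm. 4.1 analogues, audited),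
  `hmod`, `hGZK`, `hCassels`, `hC` (Česnavičius), `h33g`, `hA`, `hNS2` (Greenberg §3 local kernels,
  audited) — `hM` is NO LONGER displayed (tower-1 GEN 4's theorem
  `lemma33_localTowerKerPrimary_cyclic_of_multiplicative_holds`);
* CERTIFICATES: `hr` (analytic rank `0`), `hlow`/`hup` (layer Selmer counts), `had`, `hsha` (descent).
The ONLY memo-grade inputs left are the two typed `p = 2` packages (one unprinted field each). [cite: Kato2004Asterisque, Thm. 17.4 (p. 273), §17.13 (pp. 279–280)]
[cite: GreenbergLNM1716, Thm. 1.5, §3 pp. 85–94, §4 pp. 112–113] [cite: Miller2011LMS, Def. 1.1]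
-/

set_option autoImplicit false
-- the Theorems namespace of this sub repeats the summit name by design (D-0017 nested layout: Summit.<S>.<Sub>)
set_option linter.dupNamespace false

noncomputable section

open scoped Classical MatrixGroups ModularForm

open NumberField IsDedekindDomain CongruenceSubgroup WeierstrassCurve Literature.NumberTheory.EllipticCurves
  Literature.NumberTheory.EllipticCurves.ModularForms Literature.NumberTheory.EllipticCurves.Rank1Residual
  Literature.NumberTheory.EllipticCurves.Rank1Residual.Typed
  Literature.NumberTheory.EllipticCurves.Greenberg1999
  Summit.BirchSwinnertonDyer.Rank1Residual.X5 Summit.BirchSwinnertonDyer.Rank1Residual.X5.O1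
  Summit.BirchSwinnertonDyer.Rank1Residual.X5.Instances
  Summit.BirchSwinnertonDyer.BirchSwinnertonDyer.Theorems.MultKatoInputs
  Summit.BirchSwinnertonDyer.BirchSwinnertonDyer.Theorems.MultKatoRat

namespace Summit.BirchSwinnertonDyer.BirchSwinnertonDyer.Theorems.MultTowerClass

/-- **`MissingUpperBoundAt 100342a1 2` (item 19922 AT this curve), layer pair `(0,3)`, on the K11 kernel
road**: mult-2's `missingUpperBoundAt_two_100342a1_l03` with `hKato` supplied by
`katoMultiplicativeDivisibilityRat_forall_two_of_inputs` (five named inputs) and `hM` by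
`lemma33_localTowerKerPrimary_cyclic_of_multiplicative_holds`. Displayed: KATO FACTS {hne, h12, hns, hsp}
+ PRINT {h15, h41ns', h41sp, hmod, hGZK, hCassels, hC, h33g, hA, hNS2} + CERT {hr, hlow, hup, had}.
[cite: Kato2004Asterisque, Thm. 17.4 (1)(2) (p. 273; shape) and §17.13 (pp. 279–280)]
[cite: GreenbergLNM1716, §3 pp. 85–94 and §4 pp. 112–113] -/
theorem missingUpperBoundAt_two_100342a1_l03_of_katoInputs (hne : Kato2004.nonempty_iwasawaH1Data)
    (h12 : Kato2004.thm12_4) (hns : exists_multDivisibilityInputs_nonsplit_two)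
    (hsp : exists_multDivisibilityInputs_split_two) (h15 : thm15_isTorsion_multiplicative_rat)
    (h41ns' : thm41Analogue_charValue_rankZero_numberField_anyPrime_oddLocalDegree)
    (h41sp : thm41Analogue_charValue_rankZero_split_baseChange_anyPrime)
    (hmod : nonempty_modularParametrizationData)
    (hGZK : rank_eq_analyticRank_of_analyticRank_le_one)
    (hCassels : bsdRHS_eq_of_isIsogenous)
    (hC : cesnavicius_not_two_dvd_maninConstant_of_two_dvd_level)
    (h33g : lemma33_localTowerKerPrimary_eq_bot_of_good.{0})
    (hA : lemma33_natCard_localTowerKerPrimary_le_four_of_additive.{0})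
    (hNS2 : sec3_natCard_localTowerKerPrimary_le_four_nonsplitMultiplicative_two)
    (hr : c100342a1.analyticRank = 0) {a d : ℕ}
    (hlow : ∀ κ : ZpExtension ℚ 2, κ.IsCyclotomic →
      2 ^ a ≤ Nat.card {z : c100342a1.selmerLayer κ 0 // 2 • z = 0})
    (hup : ∀ κ : ZpExtension ℚ 2, κ.IsCyclotomic →
      Nat.card {z : c100342a1.selmerLayer κ 3 // 2 • z = 0} ≤ 2 ^ d)
    (had : d + 0 + 3 ≤ 7 + a) : MissingUpperBoundAt c100342a1 2 :=
  missingUpperBoundAt_two_100342a1_l03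
    (katoMultiplicativeDivisibilityRat_forall_two_of_inputs hne h12 hns hsp h15) h41ns' h41sp hmod hGZK
    hCassels hC h33g lemma33_localTowerKerPrimary_cyclic_of_multiplicative_holds hA hNS2 hr hlow hup had

/-- **`BSD(100342a1, 2)` on the K11 kernel road**: mult-2's `bsdp_two_100342a1_l03` with `hKato` from the
five named facts and `hM` discharged; the remaining displayed binders are KATO FACTS + PRINT + per-curve
CERTIFICATES (`hsha` = the descent lower bound). Not a booking. [cite: Miller2011LMS, Def. 1.1]
[cite: Kato2004Asterisque, Thm. 17.4 (p. 273) and §17.13] [cite: GreenbergLNM1716, §3 pp. 85–94 and §4 pp. 112–113] -/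
theorem bsdp_two_100342a1_l03_of_katoInputs (hne : Kato2004.nonempty_iwasawaH1Data)
    (h12 : Kato2004.thm12_4) (hns : exists_multDivisibilityInputs_nonsplit_two)
    (hsp : exists_multDivisibilityInputs_split_two) (h15 : thm15_isTorsion_multiplicative_rat)
    (h41ns' : thm41Analogue_charValue_rankZero_numberField_anyPrime_oddLocalDegree)
    (h41sp : thm41Analogue_charValue_rankZero_split_baseChange_anyPrime)
    (hmod : nonempty_modularParametrizationData)
    (hGZK : rank_eq_analyticRank_of_analyticRank_le_one)
    (hCassels : bsdRHS_eq_of_isIsogenous)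
    (hC : cesnavicius_not_two_dvd_maninConstant_of_two_dvd_level)
    (h33g : lemma33_localTowerKerPrimary_eq_bot_of_good.{0})
    (hA : lemma33_natCard_localTowerKerPrimary_le_four_of_additive.{0})
    (hNS2 : sec3_natCard_localTowerKerPrimary_le_four_nonsplitMultiplicative_two)
    (hr : c100342a1.analyticRank = 0) {a d : ℕ}
    (hlow : ∀ κ : ZpExtension ℚ 2, κ.IsCyclotomic →
      2 ^ a ≤ Nat.card {z : c100342a1.selmerLayer κ 0 // 2 • z = 0})
    (hup : ∀ κ : ZpExtension ℚ 2, κ.IsCyclotomic →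
      Nat.card {z : c100342a1.selmerLayer κ 3 // 2 • z = 0} ≤ 2 ^ d)
    (had : d + 0 + 3 ≤ 7 + a) (hsha : MissingLowerBoundAt c100342a1 2) : BSDp c100342a1 2 :=
  bsdp_two_100342a1_l03
    (katoMultiplicativeDivisibilityRat_forall_two_of_inputs hne h12 hns hsp h15) h41ns' h41sp hmod hGZK
    hCassels hC h33g lemma33_localTowerKerPrimary_cyclic_of_multiplicative_holds hA hNS2 hr hlow hup had
    hsha

end Summit.BirchSwinnertonDyer.BirchSwinnertonDyer.Theorems.MultTowerClass

end
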